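import Literature.MathematicalPhysics.QuantumFieldTheory.Balaban1983to89.B8Prop6CubeMemberScalarGammaPrinted
import Literature.MathematicalPhysics.QuantumFieldTheory.Balaban1983to89.B8Ineq159FlatCubeMemberSCGamma

/-!
# `Balaban1983to89.B8Prop6CubeMemberScalarGammaOfIneq159Printed` — [Balaban1985RegularSpaces] PROPOSITION 6 (p. 99), (1.135)–(1.138), AT EVERY CUBE OF
# PRINT'S BIG-BLOCK SUB-LATTICE FROM ONE NAMED FLAT FACT: (1.59) at `U₀ = 1` on the cube member over print's class ([4] Thm 3.3 at `U = 1`, Dirichlet cube)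
# — the crown of the flat line in edition γ

statement-level skeleton of published theorems with citation tags; proofs where landed; nothing here is a claim about the
Yang–Mills mass gap

PDF held: `paper:balaban1985-cmp99-regular-spaces-gauge-fixing`; Prop. 6 p. 99, p. 98 (the cubes), Thm 4 p. 88, Prop. 3 p. 87, (1.58)–(1.62) pp. 86–87, (1.31)
p. 82 — re-read at typing.  [4] = `[Balaban1985BackgroundPropagators]` Thms 3.1–3.3 pp. 397–399; [B6] = `[Balaban1984PropagatorsII]` (2.3) p. 224, Prop. 2.6 p. 247.

CITATION HEADER (lean-in-tree rule).  Cell `pub-ymgap` (HUMAN RULING D-0062, Track A), DAG node N05 = [B8], seat `pub-ymgap-dag-n05-e` g10 (R141 (C) row s3b —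
the FLAT line of Proposition 6's cube road, edition γ; file Fγ10b, the crown).  WHY THIS FILE.  The flat line reduces Proposition 6 at a cube member to flat
statements at background `1`: Theorem 4's existence half per datum (`B8Thm4ExistsAtGamma`), Proposition 5's letters from dag-n05-c's REAL families on explicit
Dirichlet matrices (PROVED: F4e∕F7∕F8∕G3), and the (1.59) clauses for `G(1)` — in edition γ over print's class (inner AND crossing bonds at every level; the β
edition over `cubeLamB` was VACUOUS at cube members, p572834).  `B8Prop6CubeMemberScalarGammaPrinted.gaugedBoundB8_cubeMember_scalar_γ_printed` (Fγ9) leaves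
per cube EXACTLY the two scalar γ clauses SC4γ∕SC2γ; `B8Ineq159FlatCubeMemberSCGamma.sc4_cubeMember_of_ineq159Printed` (Fγ10a) derives them, uniformly on
print's p. 98 sub-lattice, from dag-n05-c's ONE named fact `Ineq159FlatCubeMemberPrinted d L` (p573921).  THIS FILE composes the two: ★★★
`gaugedBoundB8_cubeMember_scalar_γ_of_ineq159Printed` — `Node00.GaugedBoundB8 L η U₀ c (7dL²·5dLB₀·Mα₀)` at every cube `c : CubeB8 d L K Ω` of print's
big-block sub-lattice above threshold (`M_h = Lˢ ≥ 3`), for every admissible `(U₀, α₀)` with «7dL²Mα₀ ≤ c₁», from the named fact ALONE (the level-0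
dictionary between dag-n05-c's class `cubeLamBP … m 0` and dag-n06-b's split class is dag-n05-w3's `mem_cubeLamBP_zero_iff_cubeLamBP'_or_crossB`, p588005).  Kind
«kernel-checked proof», one theorem, no `def`.

HONEST SCOPE ∕ A6.  CONDITIONAL on the named fact `Ineq159FlatCubeMemberPrinted d L` = [4] Thm 3.3 ∕ [B6] Prop. 2.6 at `U = 1` for the flat bond-field operator
`Δ_a` on the Dirichlet cube with print's averaging class — OPEN in the tree (lit-balaban ME #33 STAFFED for its torus-with-level-0 source; dag-n05-c the
transplant); taken as the hypothesis `h159` (the gate records a conditional result).  Its per-cube INHABITANT (non-vacuity of the flat line's SCγ hypotheses at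
every cube, constant depending on the cube) is dag-n05-w3's `exists_B0_ineq159Flat_perCube` (p585691) through `B8Ineq159FlatCubeMemberSCGamma.sc4_cubeMember_inhabited`;
the UNIFORM constant is the named fact's content.  Window `5 ≤ d·L` (the exterior-collar allowance `B_∂ = B₀` must satisfy `4B_∂ ≤ (dL − 1)B₀`; print `d = 4`).
Side conditions = print's p. 98 («M a multiple of R₁M₁», big blocks `M_h = Lˢ`) in the named fact's letters; NODE 00's carrier `CubeB8` is more permissive than
print (LOCATED-CARRIER, this seat g9), so the family-level `B8.Prop6Printed ∘ zdCub` over ALL cubes is NOT claimed from this hypothesis — the print-faithful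
sub-family is (plan g79: stub 2′).  Count-neutral; N05 NOT discharged; one finite `𝕋⁴` programme at fixed `ε`, Bałaban as printed; nothing continuum ∕ ℝ⁴ ∕ OS ∕
mass-gap ∕ Clay.  No `sorry`, no `def`, no `instance`, no `notation`.  Unit `pub-ymgap-dag-n05-e` (g10), 2026-08-28.
-/

noncomputable section

open NormedSpace

namespace Literature.MathematicalPhysics.QuantumFieldTheory.Balaban1983to89.B8Prop6CubeMemberScalarGammaOfIneq159Printed

open B7Prop1Explicit B7Prop2Explicit B7Prop1Local
open B8Ineq132 (InAk BondTouches)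
open B8Eq131CubesAdmissible (cubeFam)
open B8CubeMemberZd (cubeLamS cubeLamB)
open B8Ineq159FlatCubeMemberPrinted (cubeLamBP Ineq159FlatCubeMemberPrinted)
open B9SupplySockB9P3ZdBeta (CrossB)
open B9SupplySockB9P3ZdGamma (cubeLamBP')
open B8Ineq159FlatCubeMemberSCGamma (sc4_cubeMember_of_ineq159Printed cubeLamBP_sub_splitIndex)
open B8Prop6CubeMemberScalarGammaPrinted (gaugedBoundB8_cubeMember_scalar_γ_printed)
open Node00 (CubeB8 GaugedBoundB8)

export B7Prop1Explicit (Site)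

variable {d : ℕ}

variable {𝔸 : Type} [CStarAlgebra 𝔸] [Nontrivial 𝔸]

open Classical in
/-- ★★★ **PROPOSITION 6 (p. 99), (1.135)–(1.138) AT EVERY CUBE OF PRINT'S BIG-BLOCK SUB-LATTICE FROM THE ONE NAMED FLAT FACT `Ineq159FlatCubeMemberPrinted d L`.**
There are `B₀ ≥ 1`, `c₁ > 0` and thresholds `ρ₀, M₀, N₀, R₀` (functions of `d, L` and the named fact's constants) such that for every `η > 0`, every cube
`c : CubeB8 d L K Ω` whose datum lies on print's p. 98 sub-lattice above threshold (`M_h = Lˢ ≥ 3`, `M₀ ≤ L^{s+1}`, `L^{s+1} ∣ ρ`, `L^{s+1} ∣ M`, `R·L^{s+1} ≤ ρ`,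
`2L ≤ R`, `R₀ ≤ R`, `N₀ + 1 ≤ R·L^{s+1}`, `ρ₀ ≤ ρ`), every unitary `U₀ ∈ 𝔄_K({Ω_j}, α₀)` with `7dL²Mα₀ ≤ c₁`: `GaugedBoundB8 L η U₀ c (7dL²·5dLB₀·Mα₀)` —
Proposition 6's gauge `u` on `□̃`, the Landau gauge (1.138) at background `1`, (1.136)₁–₄ with print's constant shape, (1.137).  HYPOTHESIS: the named fact
`h159` ((1.59) at `U₀ = 1` on the cube member over print's class = [4] Thm 3.3 at `U = 1`, Dirichlet exterior — OPEN); window `5 ≤ d·L`; the level-0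
dictionary is dag-n05-w3's `mem_cubeLamBP_zero_iff_cubeLamBP'_or_crossB` (p588005) inside Fγ10a's `cubeLamBP_sub_splitIndex`.  Composition: Fγ10a `sc4_cubeMember_of_ineq159Printed` at the cube's datum with
the flat line's split index (SC4γ at `m = k`, the first two lines at every `1 ≤ m ≤ k`) into Fγ9 `gaugedBoundB8_cubeMember_scalar_γ_printed`.
[cite: Balaban1985RegularSpaces, Prop. 6 (1.135)–(1.138) p.99, p.98, Thm 4 p.88, Prop. 3 p.87, (1.59) p.86, (1.62) p.87, (1.31) p.82; Balaban1985BackgroundPropagators, Thm 3.3 p.399, Thm 3.2 (3.48) p.398, Thm 3.1 (3.47) p.398; Balaban1984PropagatorsII, Prop. 2.6 (2.136) p.247, (2.3) p.224] -/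
theorem gaugedBoundB8_cubeMember_scalar_γ_of_ineq159Printed (hd2 : 2 ≤ d) {L : ℕ} (hL : 2 ≤ L) (hdL : 5 ≤ d * L)
    (h159 : Ineq159FlatCubeMemberPrinted d L) :
    ∃ B₀ c₁ ρ₀ M₀ : ℝ, ∃ N₀ R₀ : ℕ, 1 ≤ B₀ ∧ 0 < c₁ ∧ ∀ (η : ℝ), 0 < η → ∀ {K : ℕ} {Ω : ℕ → Set (Site d)} (c : CubeB8 d L K Ω),
      -- PRINT'S SIDE CONDITIONS (p. 98) on the cube datum in the named fact's letters (`M_h = Lˢ`), above threshold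
      ∀ (s R : ℕ), 3 ≤ L ^ s → M₀ ≤ (L : ℝ) ^ (s + 1) → L ^ (s + 1) ∣ c.ρ → L ^ (s + 1) ∣ c.M → R * L ^ (s + 1) ≤ c.ρ → 2 * L ≤ R →
        R₀ ≤ R → N₀ + 1 ≤ R * L ^ (s + 1) → ρ₀ ≤ (c.ρ : ℝ) →
      ∀ (U₀ : Site d → Fin d → 𝔸ˣ), (∀ x κ, U₀ x κ ∈ unitaryUnits 𝔸) → ∀ (α₀ : ℝ), 0 < α₀ → InAk L K η α₀ Ω U₀ →
      7 * d * (L : ℝ) ^ 2 * c.M * α₀ ≤ c₁ →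
      GaugedBoundB8 L η U₀ c (7 * d * (L : ℝ) ^ 2 * (5 * (d : ℝ) * L * B₀) * c.M * α₀) := by
  have hL1 : 1 ≤ L := le_trans (by norm_num) hL
  obtain ⟨B₀, ρ₀, M₀, N₀, R₀, hB₀, SC⟩ := sc4_cubeMember_of_ineq159Printed hd2 hL1 h159
  have hB₀pos : 0 < B₀ := lt_of_lt_of_le one_pos hB₀
  have hdr : (2 : ℝ) ≤ d := by exact_mod_cast hd2
  have hLr : (2 : ℝ) ≤ L := by exact_mod_cast hL
  have hdLr : (5 : ℝ) ≤ (d : ℝ) * L := by exact_mod_cast hdL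
  have hB : 2 ≤ 5 * (d : ℝ) * L * B₀ := by nlinarith [hB₀, hdr, hLr]
  have hBd : 4 * B₀ ≤ ((d : ℝ) * L - 1) * B₀ := by nlinarith [hB₀, hdLr]
  obtain ⟨c₁, ρ₁, M₁, N₁, hc₁, P6⟩ := gaugedBoundB8_cubeMember_scalar_γ_printed (𝔸 := 𝔸) hd2 hL hB₀pos hB hB₀pos.le hBd
  refine ⟨B₀, c₁, max ρ₀ ρ₁, max M₀ M₁, max N₀ N₁, R₀, hB₀, hc₁, ?_⟩
  intro η hη K Ω c s R hMh hM₀ hdρ hdM hRρ h2L hR₀ hN₀ hρ₀ U₀ hU₀ α₀ hα hA hs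
  -- the cube's laws
  have hk : 1 ≤ c.k := c.one_le_k
  have hρL : L ≤ c.ρ := c.L_le_ρ
  -- print's side conditions in Fγ9's letters (`M_h := Lˢ`)
  have hMhL : L ^ s * L = L ^ (s + 1) := (pow_succ L s).symm
  have hLMh : L * L ^ s = L ^ (s + 1) := by rw [mul_comm]; exact hMhL
  have hM₁ : M₁ ≤ (L : ℝ) * (L ^ s : ℕ) := by
    have : ((L : ℝ) * (L ^ s : ℕ)) = (L : ℝ) ^ (s + 1) := by push_cast; ring
    rw [this]; exact (le_max_right _ _).trans hM₀
  have hM₀' : M₀ ≤ (L : ℝ) ^ (s + 1) := (le_max_left _ _).trans hM₀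
  have hN₁ : N₁ + 1 ≤ R * (L * L ^ s) := by rw [hLMh]; exact le_trans (Nat.succ_le_succ (le_max_right _ _)) hN₀
  have hN₀' : N₀ + 1 ≤ R * L ^ (s + 1) := le_trans (Nat.succ_le_succ (le_max_left _ _)) hN₀
  have hρ₁ : ρ₁ ≤ (c.ρ : ℝ) := (le_max_right _ _).trans hρ₀
  have hρ₀' : ρ₀ ≤ (c.ρ : ℝ) := (le_max_left _ _).trans hρ₀
  -- the SCALAR γ clauses at this cube's datum from the named fact, in the flat line's split index
  have hI : ∀ m, 1 ≤ m → m ≤ c.k → ∀ j, j ≤ m → ∀ b ∈ cubeLamBP L c.a c.M c.ρ c.k m j,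
      (b ∈ cubeLamBP' L c.a c.M c.ρ c.k m j ∨ (j = 0 ∧ CrossB (cubeFam false L c.a c.M c.ρ c.k 0) b)) :=
    fun m hm1 hmk => cubeLamBP_sub_splitIndex hL1 c.a c.M (hL1.trans hρL) hm1 hmk
  have S := fun m (hm1 : 1 ≤ m) (hmk : m ≤ c.k) =>
    SC η hη c.a c.M c.ρ c.k s R hk hρL hM₀' hdρ hdM hRρ hR₀ hN₀' hρ₀' m hm1 hmk
      (fun j b => b ∈ cubeLamBP' L c.a c.M c.ρ c.k m j ∨ (j = 0 ∧ CrossB (cubeFam false L c.a c.M c.ρ c.k 0) b)) (hI m hm1 hmk)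
  refine P6 η hη c (L ^ s) R hMh hM₁ (by rw [hMhL]; exact hdρ) (by rw [hMhL]; exact hdM) (by rw [hMhL]; exact hRρ) h2L hN₁ hρ₁
    (fun φ hLan hsupp => S c.k hk le_rfl φ hLan hsupp) U₀ hU₀ α₀ hα hA hs
    (fun m hm1 hmk φ hLan hsupp => ⟨(S m hm1 hmk φ hLan hsupp).1, (S m hm1 hmk φ hLan hsupp).2.1⟩)

#print axioms gaugedBoundB8_cubeMember_scalar_γ_of_ineq159Printed

end Literature.MathematicalPhysics.QuantumFieldTheory.Balaban1983to89.B8Prop6CubeMemberScalarGammaOfIneq159Printed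

end
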